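import Summits.AtomisticToContinuum.HydrodynamicLimit.Theorems.AntiMazurCoboundariesCorrectorPressureDecayKiferTangentEntropyDebt
import Literature.MathematicalPhysics.KineticTheory.Georgii1995HardSphereCanonicalLocalLimit

/-!
# Stub `stub_tangentEntropyBound` (F2 `TangentEntropyBound`) of line `FirstLemma` — AUDIT, DECOMPOSITION, PARTIAL REDUCTION
(crux stmt-AtomisticToContinuum-14135 `AntiMazurCoboundaries.CorrectorPressureDecay`; worker W6 of lead a1; `rc 0`, no `sorry`)

Registered: `theorem stub_tangentEntropyBound : TangentEntropyBound` (namespace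
`Summit.AtomisticToContinuum.HydrodynamicLimit.Theorems.KiferCompactification`; F2 of `…KiferTangentEntropyDebt.lean`).

## (A) AUDIT of F2 as typed — verdict: TRUE (no counterexample family found), NOT provable from the tree; its quantifier
frame ("EVERY translation-invariant Gibbs `G` of density `σ³`, ANY activity `z > 0`") silently carries the LOW-DENSITY
UNIQUENESS of the hard-sphere Gibbs state of prescribed density — published (Ruelle 1969 Thm 4.2.3; Georgii 1995 Thm 3.4,
Remark 3.7), never needed by the consumer `TangentEntropyLowDensity` (which is `∃ G`).

(ii) Junk values. Along a tangent family `KL(Q k ‖ G_{N k}) ≤ ofReal (κ (N k + 1)) < ⊤`, so `.toReal` is exact and the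
sequence `(N(ι k)+1)⁻¹ KL(…)` lies in `[0, κ]`; Mathlib's `Filter.liminf` (`sSup {a | ∀ᶠ k, a ≤ u k}`, junk `0` only for
unbounded-below or `→ +∞` sequences) is the genuine liminf, and the side conditions a prover needs
(`IsBoundedUnder (· ≥ ·)` by `0`, `IsCoboundedUnder (· ≥ ·)` from `≤ κ`) are discharged verbatim as in `stub_tangentAssembly`.
`ENNReal.ofReal` of the (nonnegative) product is exact. `N k ≥ k` and `StrictMono ι` give `N (ι k) → ∞` (needed: at fixed
`N` tangent states are blow-ups at a fixed scale and the bound is false). ✓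

(i) Constant and frame on explicit families (free energies at ideal-gas/virial order; `λ := σ³` = particles per unit
BLOWN-UP volume since `(N+1) ε_N³ = σ³`; `f(ρ)` = configurational free-energy density, `f'(ρ) = log z(ρ)`):
* Gibbs family `Q k = G_{N k}` (`KL = 0`, exactly stationary): tangent state through ANY `φ` is the local limit `G_λ` of the
  blown-up canonical laws (torus translation invariance makes the weight irrelevant); F2 then demands `h(G_λ | G) = 0` for
  every TI Gibbs `G` of density `λ` — by the Gibbs variational principle this says every such `G` IS `G_λ`: the implicit
  uniqueness content (true for `λ` below Ruelle's radius; see (B)).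
* Temperature shift `θ' = rθ` (function of the kinetic energy, exactly stationary): `KL/(N+1) → (3/2)(r − 1 − log r)`,
  tangent state = `G_λ` with Maxwellian marks at `rθ`, `h(μ | G) = λ·(3/2)(r − 1 − log r)`: EQUALITY in F2 (`φ ≡ 1`).
* Density profile `n(x)`, `∫n = 1` (time-averaged over `τ_k ℓ`, `τ_k → ∞`, to be almost stationary; a bare profile is NOT
  a tangent family: its TV-distance to its flow over micro time `N^{-1/6}` is `O(1)`): `λ KL/(N+1) → ∫ e(x) dx` with
  `e(x) = f(λ n(x)) − f(λ) − λ(n(x) − 1) f'(λ) ≥ 0` (the linear term integrates to `0` because `Q` has exactly `N+1`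
  particles — so tangent densities `ρ(μ) ≠ λ` are harmless), tangent state `μ = (∫φ)⁻¹ ∫ φ(x) G_{λ n(x)} dx`, and by
  affinity `h(μ | G_λ) = (∫φ)⁻¹ ∫ φ e ≤ (∫φ)⁻¹ ∫ e = RHS` exactly because `0 ≤ φ ≤ 1`, `e ≥ 0`: CONSISTENT, and the
  constant `(∫φ)⁻¹ σ³` is SHARP (`φ → 1_A` with the deviation supported in `A` gives equality).
* Concentration on `G`-null sets (pairs at contact `|q − q'| ∈ [ε, ε(1+η)]`, velocity shells, lattice positions), which
  would give `μ_Λ ⊥̸≪ G_Λ`, `h = ∞ > RHS`: cost `≈ log(1/(4π λ η))` per constrained particle, so the budget `κ (N+1)` only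
  constrains a fraction `κ / log(1/η_k) → 0` — no singular part in the limit. ✓ (LSC is exactly what forbids this.)
* Rigid mesoscopic cell counts (`M` cells of `m → ∞` particles conditioned to their means): cost `≈ (M/2) log m = o(N)`,
  tangent state `G_λ`, `h = 0`. ✓  Escape of velocity mass: bounded second moments per unit entropy ⇒ only `o(N)`
  particles escape; x-uniform tangent states have intensity exactly `λ`; escape only LOWERS the left side. ✓
* Units: `G_N` velocities `∝ exp(−|v − u₀|²/(2θ))` (`localMaxwellian 1 θ u₀`), `G`'s marks `maxwellianBeta θ⁻¹ (v − u₀)` —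
  identical ✓; blow-up keeps velocities and turns diameter `ε_N` into `1` ✓; `volume (centredBox n) = (2(n+1))³` ✓;
  `vol 𝕋³ = 1` ✓; the activity profile `a` cancels in the canonical law ✓; `IsHardSphereGibbs` has no junk (`gibbsWeight
  univ ≥ 1`, genuine DLR kernel on bounded windows) ✓.
(iii) The activity. If two TI Gibbs states of density `σ³` existed, F2 would be FALSE (witness: the Gibbs family above,
`h(G_λ | G') > 0 = RHS`). They do not, for `σ³ < ρ₀`: [Georgii 1995 Thm 3.4 + Remark 3.7: TI tempered Gibbs measures are the
free-energy minimisers, the sets `𝒢_Θ(z, β)` are pairwise disjoint and equal to the `ℳ_{ρ,ε}` ⇒ at fixed `β` the density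
determines the activity and is monotone in it] + [Ruelle 1969 Thm 4.2.3 (hard core: `B = 0`, `C(β) = 4π/3`): for
`z < 3/(4πe)` the Kirkwood–Salsburg equations have a unique solution ⇒ unique Gibbs state; DLR ⇒ KS: Ruelle 1970]. So F2 is
true but carries these as extra debt — recorded below as ONE composite named fact `HardSphereGibbsLowDensityUniqueness`.

## (B) DECOMPOSITION.  F2 ⇐ (E) ∧ (U) ∧ (L), reduction `stub_tangentEntropyBoundOfFacts` PROVED below (pure plumbing:
thresholds, and "every subsequence has a locally convergent sub-subsequence with limit `= G` by uniqueness ⇒ convergence"):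
* (E) `Georgii1995_hardSphereCanonicalLocalLimit` — equivalence of ensembles ON THE LEVEL OF MEASURES for the periodic
  (small-)canonical hard-sphere gas: along a subsequence the x-averaged blown-up canonical torus laws converge on every
  bounded window, setwise, to a translation-invariant hard-sphere Gibbs state of density `σ³` (Georgii 1995 Thms 3.3–3.4,
  Remark 3.6; positional version + independent Maxwellian marks). PUBLISHED, not in the tree.
* (U) `HardSphereGibbsLowDensityUniqueness` — two TI hard-sphere Gibbs states with the same marks `(β, u)` and the same
  density `< ρ₀` coincide (Ruelle 1969 Thm 4.2.3 with Ruelle 1970; Georgii 1995 Thm 3.4 / Remark 3.7). PUBLISHED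
  (composite of two theorems), not in the tree.
* (L) `TangentEntropyBoundLocal` — THE RESIDUAL ENTROPY DEBT: F2 with "`G` Gibbs of density `σ³`" replaced by "`G` is a
  probability law, translation invariant, and the setwise local limit along `ι` of the x-averaged blown-up `G_{N(ι k)}`".
  Pure relative-entropy statement (no Gibbs structure, no uniqueness); NOT a single published theorem but the standard
  argument: joint lower semicontinuity of `KL` on windows via Donsker–Varadhan (tree: `klDiv_le_of_forall_integral_le`,
  `integral_le_toReal_klDiv_add_log`; the DV supremum may be restricted to the algebra generated by `e^{-⟨ω,f⟩}`,
  `f ∈ C_c⁺`, by the multiplicative monotone-class theorem, so Laplace-functional convergence of the tangent states and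
  setwise convergence of the references suffice), convexity of `KL` in the first argument over the base point `x`
  (tree: `klDiv_sum_smul_le`, integral version needed), the tiling identity `∫_{𝕋³} KL(Q_{x,Λ} ‖ G_{N,Λ}) dx =
  ε³|Λ| · avg_{x₀} Σ_cells KL`, and APPROXIMATE SUPER-ADDITIVITY of `KL(· ‖ G_N)` over disjoint cells for the canonical
  hard-sphere reference, `Σ_cells KL(Q_cell ‖ G_{N,Λ}) ≤ KL(Q ‖ G_N) + C(σ) N/L + o(N)` (multi-information of `G_N` across
  cell boundaries: hard-core boundary layers `O(|∂Λ|)` per cell at any activity, plus the canonical constraint, `O(log N)`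
  after Poissonisation / local CLT at low density) — Olla–Varadhan–Yau 1993 Lemma 4.2 prove exactly this passage for the
  POISSON reference with a non-sharp constant; Kipnis–Landim 1999 App. 2 for lattice canonical measures. It is further
  REDUCED (PROVED, file `…KiferEntropyBoundAffinity.lean`, `stub_tangentEntropyBoundLocalOfUniform`) to its UNIT-WEIGHT case
  (L₁) `TangentEntropyBoundUniform` plus the two landed Kallenberg facts: along a subsequence realising the liminf take a
  uniform-weight tangent state `μ¹` and a tangent state `ν` of the complementary weight `1 − φ`; `tangentLaplace` is affine
  in the weight, so `μ¹ = (∫φ) μ^φ + (1 − ∫φ) ν` by Laplace uniqueness, and the lower half of affinity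
  `(∫φ) h(μ^φ | G) ≤ h(μ¹ | G)` (reverse convexity `t KL(P‖R) ≤ KL(tP + (1−t)P'‖R) + log 2`, file
  `…KiferEntropyBoundCore.lean`, p144033) yields the factor `(∫φ)⁻¹` exactly. (L₁) is the textbook "an entropy bound
  `H(Q_N | G_N) ≤ CN` passes to local-equilibrium limit points with constant `1`" and also follows by duality from the
  canonical LDP upper bound (Georgii 1994 Thm 2 / 1995 Thm 3.3) + Fenchel–Moreau + `h(· | G) = I_{z,β}` (Georgii 1995 §7).
Net: `TangentEntropyBound ⇐ (E) ∧ (U) ∧ HardCoreLawsVaguelyCompact ∧ LaplaceFunctionalDeterminesLaw ∧ (L₁)`.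
Sizes: (E), (U) are named-fact sized (statements below, relocatable to `Literature/MathematicalPhysics/StatisticalMechanics`
once `blowUp`-averaged laws are acceptable vocabulary there); (L₁) is L–XL of formalisation on top of the DV lemmas.
-/

noncomputable section

open MeasureTheory ProbabilityTheory Set Filter Topology

namespace Summit.AtomisticToContinuum.HydrodynamicLimit.Theorems.KiferCompactification

open Literature.MathematicalPhysics.KineticTheory (T3 V3 hsDiameter localGibbsLaw blowUpPoint blowUp
  Georgii1995_hardSphereCanonicalLocalLimit HardSphereGibbsLowDensityUniqueness)
open Literature.MathematicalPhysics.KineticTheory.PointProcess (laplaceFunctional specificRelEntropy)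
open Literature.Analysis.FluidPDE (HardSphereFlow Config IsHardSphereGibbs IsTranslationInvariant)
open Literature.Analysis.FunctionSpaces (PointConfig)

/-! ## (E), (U): the two named facts live in `Literature/MathematicalPhysics/KineticTheory/Georgii1995HardSphereCanonicalLocalLimit.lean`
(relocated there by the gate, p144097): `Georgii1995_hardSphereCanonicalLocalLimit`, `HardSphereGibbsLowDensityUniqueness`. -/

/-! ## (L) The residual entropy debt: F2 along local limits of the canonical reference (posited, NOT a literature fact) -/

/-- **F2 IN LOCAL-LIMIT FORM** (the pure relative-entropy content of `TangentEntropyBound`; posited). There is `σ₂ > 0`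
such that for `0 < σ < σ₂`, every tangent family `(N, Φ, Q)` with budget `κ`, every weight `0 ≤ φ ≤ 1` with `∫φ > 0`,
every translation-invariant probability tangent state `μ` along `ι`, and every translation-invariant probability law `G`
on configurations which is the SETWISE LOCAL LIMIT ALONG `ι` of the x-averaged blown-up canonical laws `G_{N(ι k)}`
(window laws on bounded windows converge on every measurable event):
`specificRelEntropy μ G ≤ (∫φ)⁻¹ · σ³ · liminf_k (N(ι k)+1)⁻¹ KL(Q(ι k) ‖ G_{N(ι k)})`. No Gibbs property or uniqueness is
involved; the (unformalised) proof is lower semicontinuity of the window entropies via Donsker–Varadhan, convexity in the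
base point, the tiling identity and approximate super-additivity of `KL(· ‖ G_N)` over disjoint macroscopic cells for the
canonical hard-sphere reference at low density (Olla–Varadhan–Yau 1993 Lemma 4.2 for the Poisson reference;
Georgii–Zessin 1993 Prop. 2.6; Kipnis–Landim 1999 App. 2 in the lattice case). Debt of line `FirstLemma`, not claimed. -/
def TangentEntropyBoundLocal : Prop :=
  ∃ σ₂ : ℝ, 0 < σ₂ ∧
  ∀ (σ a θ : ℝ) (u₀ : V3) (κ : ℝ), 0 < σ → σ < σ₂ → 0 < a → 0 < θ → 0 < κ →
  ∀ (φ : T3 → ℝ), Continuous φ → (∀ x, 0 ≤ φ x) → (∀ x, φ x ≤ 1) → 0 < ∫ x, φ x →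
  ∀ (N : ℕ → ℕ)
    (Φ : ∀ k, HardSphereFlow (Literature.Analysis.FluidPDE.Torus.geometry (Fin 3)) (hsDiameter σ (N k)) (N k + 1))
    (Q : ∀ k, Measure (Config (N k + 1) (Fin 3) T3)),
    IsTangentFamily σ a θ u₀ κ N Φ Q →
    ∀ (ι : ℕ → ℕ) (μ : Measure (PointConfig (V3 × V3))), IsTangentState σ φ N Q ι μ →
      IsProbabilityMeasure μ → IsTranslationInvariant μ →
    ∀ (G : Measure (PointConfig (V3 × V3))), IsProbabilityMeasure G → IsTranslationInvariant G →
      (∀ Λ : Set V3, MeasurableSet Λ → Bornology.IsBounded Λ → ∀ A : Set (PointConfig (V3 × V3)), MeasurableSet A →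
        Tendsto (fun k => Literature.MathematicalPhysics.KineticTheory.PointProcess.windowLaw Λ
            (((volume : Measure T3).prod
              (localGibbsLaw σ (fun _ => a) (fun _ => u₀) (fun _ => θ) (N (ι k)) (Φ (ι k)))).map
              (fun p => blowUp (hsDiameter σ (N (ι k))) p.1 p.2)) A)
          atTop (𝓝 (Literature.MathematicalPhysics.KineticTheory.PointProcess.windowLaw Λ G A))) →
      specificRelEntropy μ G ≤ ENNReal.ofReal ((∫ x, φ x)⁻¹ * σ ^ 3 *
        liminf (fun k => ((N (ι k) + 1 : ℕ) : ℝ)⁻¹ *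
          (InformationTheory.klDiv (Q (ι k))
            (localGibbsLaw σ (fun _ => a) (fun _ => u₀) (fun _ => θ) (N (ι k)) (Φ (ι k)))).toReal) atTop)

/-! ## The reduction: F2 from (E), (U), (L) -/

/-- **`TangentEntropyBound` from equivalence of ensembles (E), low-density uniqueness (U) and the local-limit form (L).**
Below `min σ₂ (min (1/2) ρ₀)` (so that `σ³ ≤ σ < ρ₀` and `σ ≤ 1/2`): given a translation-invariant Gibbs `G` of density `σ³`,
every subsequence of the blown-up canonical laws along `ι` has, by (E), a further subsequence converging locally to some
translation-invariant Gibbs `G'` of density `σ³`, and `G' = G` by (U); hence (`Filter.tendsto_of_subseq_tendsto`) the whole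
sequence converges locally to `G`, and (L) gives the bound. -/
theorem stub_tangentEntropyBoundOfFacts :
    Georgii1995_hardSphereCanonicalLocalLimit → HardSphereGibbsLowDensityUniqueness → TangentEntropyBoundLocal →
      TangentEntropyBound := by
  intro hE hU hL
  obtain ⟨ρ₀, hρ₀, hU⟩ := hU (Fin 3) 1 one_pos
  obtain ⟨σ₂, hσ₂, hL⟩ := hL
  refine ⟨min σ₂ (min (1 / 2) ρ₀), lt_min hσ₂ (lt_min (by norm_num) hρ₀), ?_⟩
  intro σ a θ u₀ κ hσ hσlt ha hθ hκ φ hφ hφ0 hφ1 hφi N Φ Q hfam ι μ hμ hμP hμT z G hz hG hGT hGd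
  have hσ₂' : σ < σ₂ := hσlt.trans_le (min_le_left _ _)
  have hσhalf : σ ≤ 1 / 2 := (hσlt.trans_le ((min_le_right _ _).trans (min_le_left _ _))).le
  have hσρ : σ ^ 3 < ρ₀ := by
    have h1 : σ < ρ₀ := hσlt.trans_le ((min_le_right _ _).trans (min_le_right _ _))
    have h2 : σ ≤ 1 := hσhalf.trans (by norm_num)
    have h3 : σ ^ 3 ≤ σ := by
      calc σ ^ 3 = σ * (σ * σ) := by ring
        _ ≤ σ * (1 * 1) := by gcongr
        _ = σ := by ring
    exact h3.trans_lt h1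
  refine hL σ a θ u₀ κ hσ hσ₂' ha hθ hκ φ hφ hφ0 hφ1 hφi N Φ Q hfam ι μ hμ hμP hμT G hG.1 hGT ?_
  -- the blown-up canonical laws converge locally to `G` along `ι`
  intro Λ hΛ hΛb A hA
  refine Filter.tendsto_of_subseq_tendsto fun ns hns => ?_
  have hNk : ∀ k, k ≤ N k := hfam.1
  have hι : StrictMono ι := hμ.1
  have hN' : Tendsto (fun j => N (ι (ns j))) atTop atTop := by
    refine tendsto_atTop_mono (fun j => ?_) hns
    exact (hι.id_le (ns j)).trans (hNk _)
  obtain ⟨κ', -, z', G', hz', hG', hG'T, hG'd, hconv⟩ :=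
    hE σ a θ u₀ hσ hσhalf ha hθ (fun j => N (ι (ns j))) (fun j => Φ (ι (ns j))) hN'
  have hdens : Literature.MathematicalPhysics.KineticTheory.PointProcess.density G' < ENNReal.ofReal ρ₀ := by
    rw [hG'd]
    exact (ENNReal.ofReal_lt_ofReal_iff hρ₀).2 hσρ
  have hGG : G' = G :=
    hU θ⁻¹ u₀ z' z G' G (inv_pos.2 hθ) hz' hz hG' hG hG'T hGT (by rw [hG'd, hGd]) hdens
  refine ⟨κ', ?_⟩
  have h := hconv Λ hΛ hΛb A hA
  rw [hGG] at h
  exact h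

end Summit.AtomisticToContinuum.HydrodynamicLimit.Theorems.KiferCompactification

end
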